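import Mathlib
import Literature.MathematicalPhysics.QuantumFieldTheory.Balaban1983to89.B5Hk165ActionZd

/-!
# Bałaban [B5] (1.65), scalar, whole lattice `ℤ^d`: the action `Δ_k` AS A SYMMETRIC BILINEAR FORM —
# symmetry of `(Q'G'Q'*)⁻¹`, the polarised identity `⟨B₁, Δ_kB₂⟩ = ⟨∂H_kB₁, ∂H_kB₂⟩`, the Gram-matrix reading
# `Δ_k(y₁,y₂) = ⟨∂H_k(·,y₁), ∂H_k(·,y₂)⟩`, and Cauchy–Schwarz for `Δ_k`

**Source (verbatim; the quotation LOCATES the identity — nothing printed is used as a hypothesis).**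
[B5] = T. Bałaban, *Propagators and renormalization transformations for lattice gauge theories. I*, Commun. Math.
Phys. **95** (1984) 17–40 [`Balaban1984PropagatorsI`], p. 29 [PDF 13]: «Let us now come back to the integral
(1.47). We make the translation A = A′ + H_kB and using the above properties of H_kB, we get
((ST)^k e^{−S})(B) = Z_k exp(−½⟨∂H_kB, ∂H_kB⟩). (1.64) The action Δ_k is thus defined by
⟨B, Δ_kB⟩ = ⟨∂H_kB, ∂H_kB⟩. (1.65)».  A quadratic form «defines» an operator through its symmetric bilinear
(polarised) form; this file makes that reading kernel-explicit for the scalar whole-lattice objects of this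
seat's nodes 5–8.

**What is proved here (zero `sorry`; every `d`, every block side `n + 1 ≥ 1`, every `a > 0`).**  Objects: sites
`X d = ℤ^d`, the scalar `(Q'G'Q'*)⁻¹ = Kinv` (node 5, `B5Hk103ScalarZd`), `H = kerH`, `HB = Σ_{y∈T} B(y)H(·,y)`
and `energy` (node 7, `B5Hk103Minimizer`), the action kernel `actionKer = Kinv − a·δ` and form `actionForm`
(node 8, `B5Hk165ActionZd`; dictionary «⟨∂A, ∂A⟩ = η^{d−2}·energy A, η = (n+1)⁻¹», so that node 8's
`energy_HB_eq'` reads `⟨∂HB, ∂HB⟩ = ⟨B, Δ_k^{scalar}B⟩`).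
* §1 **`Kinv_symm`** — `(Q'G'Q'*)⁻¹(y,y') = (Q'G'Q'*)⁻¹(y',y)` on `ℤ^d` (node 2's `B4Sect5Exhaustion.limInv_symm`
  with node 4's `B6QGQDecay237.hyp56Z_KerQGQ_unif`), hence **`actionKer_symm`**: `Δ_k^{scalar}` is symmetric.
* §2 [folklore] the bilinear forms: `energy₂ A A' = Σ_μ Σ'_p ∇_μA·∇_μA'` (`energy₂_self`, `energy₂_comm`) and
  `actionForm₂ n a T B₁ B₂ = Σ_{y'',y∈T} B₁(y'')B₂(y)Δ^{scalar}(y'',y)` (`actionForm₂_self`, `actionForm₂_comm` —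
  the latter USES §1).
* §3 **`energy₂_HB_eq` — (1.65) POLARISED, scalar, `ℤ^d`**: for `B₂` supported in the finset `T` (and any `B₁`),
  `energy₂ (HB B₁) (HB B₂) = ((n+1)^d/(n+1)²)·actionForm₂ n a T B₁ B₂`, i.e. `⟨∂H_kB₁, ∂H_kB₂⟩ = ⟨B₁, Δ_kB₂⟩`
  (node 6's polarised summation by parts `tsum_lapRow_mul₂`, node 7's `lapRow_HB` / `sum_B_HB`, node 5's
  `tsum_blocks`, and §1 for the order of the arguments); `energy₂_HB_eq'` (division-free).
* §4 **`energy₂_kerH_col_eq` — the Gram-matrix reading**: `(n+1)²·energy₂ H(·,y₁) H(·,y₂) = (n+1)^d·Δ^{scalar}(y₁,y₂)`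
  for ALL `y₁, y₂` — the kernel of `Δ_k^{scalar}` is the matrix of Dirichlet pairings of the columns of `H`
  (node 8's `energy_kerH_col_eq` is the diagonal).
* §5 [folklore] `actionForm_add_smul` (expansion of `actionForm (B₁ + tB₂)`) and **`actionForm₂_sq_le`** —
  Cauchy–Schwarz `⟨B₁, Δ_kB₂⟩² ≤ ⟨B₁, Δ_kB₁⟩⟨B₂, Δ_kB₂⟩` (node 8's `actionForm_nonneg` and the discriminant).

RELATION TO THE TREE (by name; nothing is imported from `Beta/`): for the GENUINE vector operator on finite tori
the corresponding structural facts are `Beta.BlockEffectiveAction.DelK_conjTranspose` / `DelK_posSemidef`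
(unit b2b-balaban-beta-an5, typed matrices); the present file is the scalar, infinite-volume (`ℤ^d`, `Σ'`)
counterpart in the whole-lattice line of nodes 5–9, where symmetry is NOT automatic (the inverse `Kinv` is an
infinite-volume limit of finite-volume inverses) and the polarised identity is an `ℓ²` statement.

HONEST SCOPE.  (i) SCALAR analogue (plain block means, no gauge condition); (ii) WHOLE lattice `ℤ^d`, coarse
fields supported in a finset `T`; (iii) (1.66)–(1.67) are not touched here (the left half of (1.67) is node 9,
`B5Ineq167LowerZd`); (iv) NOT summit progress — kernel discharge of the scalar infinite-volume column.

ABSOLUTE-RULE CENSUS: every theorem below is proved outright from the tree modules named above and Mathlib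
(sorry-free; axioms `propext`, `Classical.choice`, `Quot.sound` only); no quoted statement is used as a hypothesis;
the hypotheses of the headline theorems are `0 < a` and `supp B ⊆ T`.  Unit `b2b-balaban-pv23-g7` (surge node
prover #23, gen 7; journal claim B5-165-POLAR-SCALAR-ZD).
-/

namespace Literature.MathematicalPhysics.QuantumFieldTheory.Balaban1983to89.B5Hk165PolarZd

open Finset Real Filter Topology
open B4Sect5Exhaustion B6QGQLower276 B6QGQDecay237 B5Hk103ScalarZd B5Hk103Unique B5Hk103Minimizer
  B5Hk165ActionZd

noncomputable section

variable {d : ℕ}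

/-! ## §1  Symmetry of `(Q'G'Q'*)⁻¹` and of the action kernel on `ℤ^d` -/

/-- **`(Q'G'Q'*)⁻¹` is symmetric on `ℤ^d`**: `Kinv n a y y' = Kinv n a y' y` (the infinite-volume inverse of the
symmetric kernel `Q'G'Q'*`, by `B4Sect5Exhaustion.limInv_symm`). [folklore] -/
theorem Kinv_symm (n : ℕ) {a : ℝ} (ha : 0 < a) (y y' : X d) : Kinv n a y y' = Kinv n a y' y := by
  unfold Kinv
  exact limInv_symm (gammaQ_pos d ha) (cU_pos d ha) (deltaU_pos d ha) (hyp56Z_KerQGQ_unif n ha) (y, 0) (y', 0)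

/-- **The scalar action kernel `Δ^{scalar} = (Q'G'Q'*)⁻¹ − a·δ` is symmetric.**
[cite: Balaban1984PropagatorsI, (1.65) p.29] -/
theorem actionKer_symm (n : ℕ) {a : ℝ} (ha : 0 < a) (y'' y : X d) :
    actionKer n a y'' y = actionKer n a y y'' := by
  unfold actionKer
  rw [Kinv_symm n ha y'' y]
  by_cases h : y'' = y
  · subst h; rfl
  · rw [if_neg h, if_neg (Ne.symm h)]

/-! ## §2  The bilinear forms [folklore] -/

/-- The Dirichlet PAIRING in site units: `energy₂ A A' = Σ_μ Σ'_p (A(p) − A(p+e_μ))(A'(p) − A'(p+e_μ))`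
(`= η^{2−d}⟨∂A, ∂A'⟩`). [folklore] -/
def energy₂ (A A' : X d → ℝ) : ℝ := ∑ μ : Fin d, ∑' p, (A p - A (p + e μ)) * (A' p - A' (p + e μ))

/-- `energy₂ A A = energy A`. [folklore] -/
theorem energy₂_self (A : X d → ℝ) : energy₂ A A = energy A := by
  unfold energy₂ energy
  exact Finset.sum_congr rfl fun μ _ => tsum_congr fun p => by ring

/-- `energy₂` is symmetric. [folklore] -/
theorem energy₂_comm (A A' : X d → ℝ) : energy₂ A A' = energy₂ A' A := by
  unfold energy₂
  exact Finset.sum_congr rfl fun μ _ => tsum_congr fun p => by ring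

/-- The coarse ACTION PAIRING of two fields supported in `T`: `Σ_{y'',y∈T} B₁(y'')B₂(y)Δ^{scalar}(y'',y)`.
[cite: Balaban1984PropagatorsI, (1.65) p.29] -/
def actionForm₂ (n : ℕ) (a : ℝ) (T : Finset (X d)) (B₁ B₂ : X d → ℝ) : ℝ :=
  ∑ y'' ∈ T, ∑ y ∈ T, B₁ y'' * B₂ y * actionKer n a y'' y

/-- `actionForm₂ B B = actionForm B`. [folklore] -/
theorem actionForm₂_self (n : ℕ) (a : ℝ) (T : Finset (X d)) (Bf : X d → ℝ) :
    actionForm₂ n a T Bf Bf = actionForm n a T Bf := rfl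

/-- **`actionForm₂` is symmetric** (by the symmetry of the action kernel, §1). [folklore] -/
theorem actionForm₂_comm (n : ℕ) {a : ℝ} (ha : 0 < a) (T : Finset (X d)) (B₁ B₂ : X d → ℝ) :
    actionForm₂ n a T B₁ B₂ = actionForm₂ n a T B₂ B₁ := by
  unfold actionForm₂
  rw [Finset.sum_comm]
  refine Finset.sum_congr rfl fun y _ => Finset.sum_congr rfl fun y'' _ => ?_
  rw [actionKer_symm n ha y'' y]
  ring

/-! ## §3  (1.65) polarised: `⟨∂H_kB₁, ∂H_kB₂⟩ = ⟨B₁, Δ_kB₂⟩` [print-located; proved outright] -/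

/-- Block sums of `((−Δ)HB₁)·HB₂`: on the block `B(y'')`, `(−Δ)HB₁` is the constant
`Σ_y B₁(y)Δ^{scalar}(y'',y)/(n+1)²` and `Σ_{B(y'')} HB₂ = (n+1)^d B₂(y'')`. [folklore] -/
theorem sum_B_lapRow_HB_mul₂ (n : ℕ) {a : ℝ} (ha : 0 < a) (T : Finset (X d)) (B₁ B₂ : X d → ℝ)
    (hT₂ : ∀ y ∉ T, B₂ y = 0) (y'' : X d) :
    ∑ q ∈ B n y'', lapRow (HB n a T B₁) q * HB n a T B₂ q =
      (∑ y ∈ T, B₁ y * (actionKer n a y'' y / ((n : ℝ) + 1) ^ 2)) * (((n : ℝ) + 1) ^ d * B₂ y'') := by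
  classical
  rw [← sum_B_HB n ha T B₂ hT₂ y'', Finset.mul_sum]
  refine Finset.sum_congr rfl fun q hq => ?_
  rw [lapRow_HB n ha T B₁ q, mem_B.1 hq]
  rfl

/-- **(1.65) polarised, scalar, `ℤ^d`**: `energy₂ (HB B₁) (HB B₂) = ((n+1)^d/(n+1)²)·actionForm₂ n a T B₁ B₂`
— `⟨∂H_kB₁, ∂H_kB₂⟩ = Σ_{y'',y} B₁(y'')B₂(y)((Q'G'Q'*)⁻¹(y'',y) − aδ_{y''y}) = ⟨B₁, Δ_kB₂⟩` for every `B₂`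
supported in `T`. [cite: Balaban1984PropagatorsI, (1.65) p.29] -/
theorem energy₂_HB_eq (n : ℕ) {a : ℝ} (ha : 0 < a) (T : Finset (X d)) (B₁ B₂ : X d → ℝ)
    (hT₂ : ∀ y ∉ T, B₂ y = 0) :
    energy₂ (HB n a T B₁) (HB n a T B₂) = ((n : ℝ) + 1) ^ d / ((n : ℝ) + 1) ^ 2 * actionForm₂ n a T B₁ B₂ := by
  classical
  have h1 := summable_HB_sq n ha T B₁
  have h2 := summable_HB_sq n ha T B₂
  have hE : energy₂ (HB n a T B₁) (HB n a T B₂) = ∑' p, lapRow (HB n a T B₁) p * HB n a T B₂ p := by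
    rw [tsum_lapRow_mul₂ h1 h2]; rfl
  rw [hE, ← tsum_blocks n (summable_lapRow_mul₂ h1 h2)]
  simp only [sum_B_lapRow_HB_mul₂ n ha T B₁ B₂ hT₂]
  rw [tsum_eq_sum (s := T) fun y'' hy'' => by rw [hT₂ y'' hy'', mul_zero, mul_zero]]
  rw [actionForm₂_comm n ha, actionForm₂, Finset.mul_sum]
  refine Finset.sum_congr rfl fun y'' _ => ?_
  rw [Finset.sum_mul, Finset.mul_sum]
  refine Finset.sum_congr rfl fun y _ => ?_
  ring

/-- The same identity with the print's normalisation explicit: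
`(n+1)²·energy₂ (HB B₁) (HB B₂) = (n+1)^d·actionForm₂ B₁ B₂` (no division). [folklore] -/
theorem energy₂_HB_eq' (n : ℕ) {a : ℝ} (ha : 0 < a) (T : Finset (X d)) (B₁ B₂ : X d → ℝ)
    (hT₂ : ∀ y ∉ T, B₂ y = 0) :
    ((n : ℝ) + 1) ^ 2 * energy₂ (HB n a T B₁) (HB n a T B₂) = ((n : ℝ) + 1) ^ d * actionForm₂ n a T B₁ B₂ := by
  have hc : ((n : ℝ) + 1) ^ 2 ≠ 0 := by positivity
  rw [energy₂_HB_eq n ha T B₁ B₂ hT₂]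
  field_simp

/-! ## §4  The Gram-matrix reading of the action kernel [folklore] -/

/-- **`Δ^{scalar}(y₁,y₂) = ((n+1)²/(n+1)^d)·⟨∇H(·,y₁), ∇H(·,y₂)⟩` for all `y₁, y₂`**: the action kernel is the
matrix of Dirichlet pairings of the columns of `H` (node 8's `energy_kerH_col_eq` is the diagonal). [folklore] -/
theorem energy₂_kerH_col_eq (n : ℕ) {a : ℝ} (ha : 0 < a) (y₁ y₂ : X d) :
    ((n : ℝ) + 1) ^ 2 * energy₂ (fun p => kerH n a p y₁) (fun p => kerH n a p y₂) =
      ((n : ℝ) + 1) ^ d * actionKer n a y₁ y₂ := by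
  classical
  set T : Finset (X d) := {y₁, y₂} with hTdef
  have hy₁ : y₁ ∈ T := by simp [hTdef]
  have hy₂ : y₂ ∈ T := by simp [hTdef]
  have hT₂ : ∀ y ∉ T, (fun y : X d => if y = y₂ then (1 : ℝ) else 0) y = 0 := by
    intro y hy
    have : y ≠ y₂ := fun h => hy (h ▸ hy₂)
    simp [this]
  have hH₁ : HB n a T (fun y => if y = y₁ then (1 : ℝ) else 0) = fun p => kerH n a p y₁ := by
    funext p; simp [HB, Finset.sum_ite_eq', hy₁]
  have hH₂ : HB n a T (fun y => if y = y₂ then (1 : ℝ) else 0) = fun p => kerH n a p y₂ := by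
    funext p; simp [HB, Finset.sum_ite_eq', hy₂]
  have h := energy₂_HB_eq' n ha T (fun y => if y = y₁ then (1 : ℝ) else 0)
    (fun y => if y = y₂ then (1 : ℝ) else 0) hT₂
  rw [hH₁, hH₂] at h
  rw [h, actionForm₂]
  simp [Finset.sum_ite_eq', hy₁, hy₂]

/-! ## §5  Expansion and Cauchy–Schwarz for the action form [folklore] -/

/-- `actionForm (B₁ + tB₂) = actionForm B₁ + 2t·actionForm₂ B₁ B₂ + t²·actionForm B₂` (uses the symmetry §1).
[folklore] -/
theorem actionForm_add_smul (n : ℕ) {a : ℝ} (ha : 0 < a) (T : Finset (X d)) (B₁ B₂ : X d → ℝ) (t : ℝ) :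
    actionForm n a T (fun y => B₁ y + t * B₂ y) =
      actionForm n a T B₁ + 2 * actionForm₂ n a T B₁ B₂ * t + actionForm n a T B₂ * t ^ 2 := by
  have hc := actionForm₂_comm n ha T B₁ B₂
  unfold actionForm actionForm₂ at *
  have hexp : ∀ y'' y : X d, (B₁ y'' + t * B₂ y'') * (B₁ y + t * B₂ y) * actionKer n a y'' y =
      B₁ y'' * B₁ y * actionKer n a y'' y + t * (B₁ y'' * B₂ y * actionKer n a y'' y) +
        t * (B₂ y'' * B₁ y * actionKer n a y'' y) + t ^ 2 * (B₂ y'' * B₂ y * actionKer n a y'' y) := by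
    intro y'' y; ring
  simp only [hexp, Finset.sum_add_distrib, ← Finset.mul_sum]
  rw [← hc]
  ring

/-- **Cauchy–Schwarz for `Δ_k^{scalar}`**: `⟨B₁, Δ_kB₂⟩² ≤ ⟨B₁, Δ_kB₁⟩·⟨B₂, Δ_kB₂⟩` for `B₁, B₂` supported in `T`
(positivity of the action form, node 8, and the discriminant). [folklore] -/
theorem actionForm₂_sq_le (n : ℕ) {a : ℝ} (ha : 0 < a) (T : Finset (X d)) (B₁ B₂ : X d → ℝ)
    (hT₁ : ∀ y ∉ T, B₁ y = 0) (hT₂ : ∀ y ∉ T, B₂ y = 0) :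
    actionForm₂ n a T B₁ B₂ ^ 2 ≤ actionForm n a T B₁ * actionForm n a T B₂ := by
  have h : ∀ t : ℝ, 0 ≤ actionForm n a T B₂ * (t * t) + 2 * actionForm₂ n a T B₁ B₂ * t + actionForm n a T B₁ :=
    fun t => by
    have h0 := actionForm_nonneg n ha T (fun y => B₁ y + t * B₂ y)
      (fun y hy => by simp only [hT₁ y hy, hT₂ y hy, mul_zero, add_zero])
    rw [actionForm_add_smul n ha T B₁ B₂ t] at h0
    nlinarith [h0]
  have hd := discrim_le_zero h
  rw [discrim] at hd
  nlinarith [hd]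

end

end Literature.MathematicalPhysics.QuantumFieldTheory.Balaban1983to89.B5Hk165PolarZd
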